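import Literature.AlgebraicGeometry.ShimuraVarieties.UnitaryShimuraCurveEmbeddingClosed
import Literature.Topology.Algebra.CompactOpenSubgroupTraceMonotone
import Literature.NumberTheory.Automorphic.FinAdelicTotallyDisconnected
import Mathlib.CategoryTheory.Category.Preorder
import HarnessLib

/-!
# Monotone surface levels for the unitary Shimura CURVE inside the unitary Shimura SURFACE: the level functor along `φGS`

Topic `AlgebraicGeometry/ShimuraVarieties`, namespace `Literature.AlgebraicGeometry.ShimuraVarieties.UnitaryCanonicalModel`.  THEOREMS ONLY.

For the sub-datum `φ = φGS : U(J⋆)(𝔸_{L⁺,f}) ↪ U(H)(𝔸_{L⁺,f})` of [Liu2021] Thm. 4.15 (★ `UnitaryShimuraCurveRecord` §5, closed embedding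
★ `isClosedEmbedding_φGS`), a surface threshold `K₀` (open compact) and a curve threshold `K₀⋆` with `φ(K₀⋆) ≤ K₀`, the tree's
monotone trace lemma ★ `exists_monotone_isOpen_isCompact_subgroup_comap_eq` (with `U(H)(𝔸_f)` totally disconnected, ★
`UnitaryGroup.totallyDisconnectedSpace_finAdelic`) yields a FUNCTOR of small levels
`T : C5.SmallLevel K₀⋆ ⥤ C5.SmallLevel K₀` with `φ⁻¹(T K⋆) = K⋆` — [Deligne1971TravauxShimura] Prop. 1.15 / Variante 5.9,
[Milne2005ShimuraVarieties] Thm. 5.16 «for any compact open `K′ ⊂ G′(𝔸_f)` there is a compact open `K ⊂ G(𝔸_f)` with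
`K ∩ G′(𝔸_f) = K′` … an inverse system of regular maps compatible with the action».  This is the index bookkeeping of the
«embedded-curve descent» road to the canonical model of the unitary Shimura curve (cell `hodgecm-mathlib`, road (ii)): the surface
tower `K⋆ ↦ M_{T K⋆}` restricts along `T` to a diagram on the curve's levels.

## References
* [Deligne1971TravauxShimura] P. Deligne, *Travaux de Shimura* (1971), Prop. 1.15 p. 132, Variante 5.9 p. 157.
* [Milne2005ShimuraVarieties] J. S. Milne, *Introduction to Shimura varieties* (2005/2017), Thm. 5.16 p. 58.
* [Liu2021] Y. Liu, *Fourier–Jacobi cycles and arithmetic relative trace formula* (2021), Thm. 4.15 proof (l. 2193–2208).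
-/

set_option autoImplicit false

noncomputable section

open CategoryTheory NumberField Matrix
open Literature.NumberTheory.Automorphic Literature.NumberTheory.Automorphic.UnitaryGroup
open Literature.NumberTheory.Automorphic.Liu2021.AppendixC (C5.OpenCompactSubgroup C5.SmallLevel)

namespace Literature.AlgebraicGeometry.ShimuraVarieties.UnitaryCanonicalModel

variable (L : Type) [Field L] [NumberField L] [IsCMField L] (Jstar : Matrix (Fin 2) (Fin 2) L)
variable (Jperp : Matrix (Fin 1) (Fin 1) L) (H : Matrix (Fin 3) (Fin 3) L) (B : GL (Fin 3) L) {a : L} (ha : a ≠ 0)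
  (hB : formCongr ((IsCMField.complexConj L : L ≃ₐ[↥(maximalRealSubfield L)] L) : L →+* L) B (a • H) =
    finSum 2 1 Jstar Jperp)

/-- **The level functor along `φGS`** ([Deligne1971TravauxShimura] Prop. 1.15 + Variante 5.9; [Milne2005ShimuraVarieties] Thm. 5.16):
for a surface threshold `K₀ ≤ U(H)(𝔸_f)` and a curve threshold `K₀⋆ ≤ U(J⋆)(𝔸_f)` with `φGS(K₀⋆) ≤ K₀`, there is a functor
`T : SmallLevel K₀⋆ ⥤ SmallLevel K₀` (a MONOTONE choice of surface levels) with `φGS⁻¹(T K⋆) = K⋆` — hence `φGS(K⋆) ≤ T K⋆` —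
for every small curve level `K⋆`.  Assembled from ★ `exists_monotone_isOpen_isCompact_subgroup_comap_eq` (finite infima of
Chevalley–Platonov–Rapinchuk traces), ★ `isClosedEmbedding_φGS` and ★ `UnitaryGroup.totallyDisconnectedSpace_finAdelic`.
[cite: Milne2005ShimuraVarieties, Thm. 5.16 and proof p. 58] [cite: Deligne1971TravauxShimura, Prop. 1.15 p. 132 and Variante 5.9 p. 157]
[cite: Liu2021, Thm. 4.15 proof (FJcycle.tex l. 2193–2208)] -/
theorem exists_smallLevelFunctor_comap_φGS_eq
    (K₀ : C5.OpenCompactSubgroup ↥(finAdelic (↥(maximalRealSubfield L)) L (IsCMField.complexConj L) 3 H))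
    (K₀star : C5.OpenCompactSubgroup ↥(finAdelic (↥(maximalRealSubfield L)) L (IsCMField.complexConj L) 2 Jstar))
    (hK : K₀star.1.map (φGS L Jstar Jperp H B ha hB) ≤ K₀.1) :
    ∃ T : C5.SmallLevel K₀star ⥤ C5.SmallLevel K₀,
      ∀ Kstar : C5.SmallLevel K₀star,
        (T.obj Kstar).1.1.comap (φGS L Jstar Jperp H B ha hB) = Kstar.1.1 ∧
          Kstar.1.1.map (φGS L Jstar Jperp H B ha hB) ≤ (T.obj Kstar).1.1 := by
  haveI : TotallyDisconnectedSpace ↥(finAdelic (↥(maximalRealSubfield L)) L (IsCMField.complexConj L) 3 H) :=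
    UnitaryGroup.totallyDisconnectedSpace_finAdelic (↥(maximalRealSubfield L)) L (IsCMField.complexConj L) 3 H
  obtain ⟨Tf, hTf, hmono⟩ :=
    Literature.Topology.Algebra.exists_monotone_isOpen_isCompact_subgroup_comap_eq
      (φGS L Jstar Jperp H B ha hB) (isClosedEmbedding_φGS L Jstar Jperp H B ha hB) K₀.1 K₀.2.1 K₀.2.2 K₀star.1
      K₀star.2.2 (Subgroup.map_le_iff_le_comap.mp hK)
  -- the object map: small curve level ↦ its monotone trace, a small surface level
  let f : C5.SmallLevel K₀star → C5.SmallLevel K₀ := fun Kstar =>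
    ⟨⟨Tf Kstar.1.1, (hTf Kstar.1.1 Kstar.1.2.1 Kstar.2).1, (hTf Kstar.1.1 Kstar.1.2.1 Kstar.2).2.1⟩,
      (hTf Kstar.1.1 Kstar.1.2.1 Kstar.2).2.2.1⟩
  have hf : Monotone f := fun K₁ K₂ h => hmono K₁.1.1 K₂.1.1 h
  refine ⟨Monotone.functor hf, fun Kstar => ⟨(hTf Kstar.1.1 Kstar.1.2.1 Kstar.2).2.2.2, ?_⟩⟩
  rw [Subgroup.map_le_iff_le_comap]
  exact le_of_eq (hTf Kstar.1.1 Kstar.1.2.1 Kstar.2).2.2.2.symm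

end Literature.AlgebraicGeometry.ShimuraVarieties.UnitaryCanonicalModel

end
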